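import Summits.KontsevichZagierPeriods.Zeta5Search.Denom.TwoTaleP15Coincidence
import Summits.KontsevichZagierPeriods.Zeta5Search.TwoTaleP15LineBoundDecay
import Summits.KontsevichZagierPeriods.Zeta5Search.TwoTaleSecondTaleStripShift
import Summits.KontsevichZagierPeriods.Zeta5Search.TwoTaleSecondTaleLineRate
import Summits.KontsevichZagierPeriods.Zeta5Search.TwoTaleP15SecondLineProfileShape
import Summits.KontsevichZagierPeriods.Zeta5Search.Denom.TwoTaleP15DecayHolds

/-!
# Second tale at the P15 partner: `DecayT c` from a one-variable certificate (the `dy`-assembly)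

HONEST FRAMING: systematic search; no irrationality claim unless certified.  Cell pub-zeta5, class `measure`
(fam-measure g5, file U2-6 of RULING R3′ task U2), T3/T4.  No measure or irrationality claim is made here, and the
design value `DecayT 29.108` of `Denom.TwoTaleP15Coincidence` stays "formalisation pending" until this chain and
P1 g10's certificate `TwoTaleP15SecondLineCertificate` are in the tree; the P15 value `μ(ζ(2)) ≤ 5.0499…` stays
CONDITIONAL until then and goes to the referee first (RULING R6 (e)).

This is the tale-2 clone of `TwoTaleRungALineDecay` (p254815).  With
* U2-3/U2-4 (`abs_formT_le_of_line`, PROVED): `|q̂ₙζ(2) − p̂ₙ| ≤ (4π)⁻¹ ∫ sech1(Y) ‖g(mₙ + ½ + iY)‖ dY` (`n ≥ 1`,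
  `mₙ = 8n + ⌊3n/50⌋ ≤ 11n`), where `g(u) = R̂ₙ((u − â₀*)/2)` and `sech1(Y) = π/cosh(πY) ≤ 2π e^{−π|Y|}`;
* U2-5 (`log_norm_RCT_T_line_le`, PROVED): on that line `g(mₙ + ½ + iY) = R̂ₙ(wₙ + i·Y/2)`, `wₙ = −9n − ¾ + ⌊3n/50⌋/2`
  (`wₙ/n → ξ = −897/100`, P1 g10's certificate abscissa), and with `η = Y/(2n)`:
  `log ‖R̂ₙ(wₙ + i nη)‖ ≤ n·rateT η + 8 log(19² + (2η)²) + constLineT`;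
the decay input follows from ONE explicit inequality for the elementary function `rateT`:
* `lineIntegrandT_le` — pointwise, `Y ≠ 0`, `n ≥ 1`:
  `sech1(Y)‖g(mₙ+½+iY)‖ ≤ 2π e^{constLineT} (484+Y²)⁹ e^{nM} e^{−(δ/2)|Y|}` whenever `rateT η − (2π−δ)|η| ≤ M`
  for all `η ≠ 0`
  (the kernel decays like `e^{−π|Y|} = e^{−2π·n|η|}`: slope `2π` in the `η`-normalisation, as at rung A);
* `integral_lineIntegrandT_le` — integrated against P1's integrable majorant `(484+Y²)⁹ e^{−(δ/2)|Y|}`;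
* **`decayT_of_certificate`**: `0 < δ` → `(∀ η ≠ 0, rateT η − (2π − δ)|η| ≤ M)` → `c < −M` → `DecayT c`;
* `rateT_eq`: `rateT η = profileT0 (−897/100) η` (`η ≠ 0`; P1's `prim` = fam-denom's `gPrim`, `gPrim_scale` at `c = 2`);
* **`decayT_of_certT`**: the shape of P1 g10's `TwoTaleP15SecondLineCertificate.certT_delta`
  (`0 ≤ δ ≤ 3 → η ≠ 0 → profileT0 (−897/100) η − (2π−δ)|η| ≤ −29.10786 + 7δ`) → `c < 29.10786` → `DecayT c`.
Numerically `sup_η (rateT η − 2π|η|) = −29.1078672` at `η ≈ ±1.2915` (in-seat float cross-check = P1's design sup).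
References: W. Zudilin, arXiv:1310.1526 [Zudilin2014ZetaTwo] §6, Prop. 3, Remark 5.
-/

noncomputable section

open Real Complex MeasureTheory Filter
open Literature.NumberTheory.Irrationality.Zudilin2014
open Literature.NumberTheory.Transcendental (zetaValue)
open Summit.KontsevichZagierPeriods.Zeta5Search.TwoTaleP15 (aT bT)
open Summit.KontsevichZagierPeriods.Zeta5Search.TwoTaleLineBound
open Summit.KontsevichZagierPeriods.Zeta5Search.TwoTaleSechKernel
open Summit.KontsevichZagierPeriods.Zeta5Search.TwoTaleSecondTaleStripShift (gT abs_formT_le_of_line)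
open Summit.KontsevichZagierPeriods.Zeta5Search.TwoTaleSecondTaleLineRate
open Summit.KontsevichZagierPeriods.Zeta5Search.Denom.TwoTaleP15Coincidence (DecayT)
open Summit.KontsevichZagierPeriods.Zeta5Search.Denom.LineProfile (gPrim gPrim_scale)
open Summit.KontsevichZagierPeriods.Zeta5Search.Denom.TwoTaleP15DecayHolds (prim_eq_gPrim)
open Summit.KontsevichZagierPeriods.Zeta5Search.TwoTaleP15SecondLineProfileShape (profileT0 profileTConst)

namespace Summit.KontsevichZagierPeriods.Zeta5Search.TwoTaleSecondTaleLineDecay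

variable {M δ : ℝ}

/-- The `u`-line index `mₙ = 8n + ⌊3n/50⌋` (`Re u = mₙ + ½`, i.e. `Re t = wLineT n`; `mₙ ≤ 11n`). -/
def mLineT (n : ℕ) : ℕ := 8 * n + 3 * n / 50

/-- `mₙ ≤ 11n` (the strip-shift range). -/
theorem mLineT_le (n : ℕ) : mLineT n ≤ 11 * n := by unfold mLineT; omega

/-- `e^{|x|} ≤ 2 cosh x`. -/
private theorem exp_abs_le_two_mul_cosh (x : ℝ) : Real.exp |x| ≤ 2 * Real.cosh x := by
  rw [Real.cosh_eq]
  rcases le_or_gt 0 x with h | h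
  · rw [abs_of_nonneg h]; linarith [Real.exp_pos (-x)]
  · rw [abs_of_neg h]; linarith [Real.exp_pos x]

/-- **The kernel decays**: `sech1 Y = π/cosh(πY) ≤ 2π e^{−π|Y|}`. -/
theorem sech1_le_exp (Y : ℝ) : sech1 Y ≤ 2 * π * Real.exp (-(π * |Y|)) := by
  have h := exp_abs_le_two_mul_cosh (π * Y)
  rw [abs_mul, abs_of_pos Real.pi_pos] at h
  have e : Real.exp (-(π * |Y|)) * Real.exp (π * |Y|) = 1 := by rw [← Real.exp_add, neg_add_cancel, Real.exp_zero]
  rw [sech1, div_le_iff₀ (Real.cosh_pos _)]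
  calc π = π * (Real.exp (-(π * |Y|)) * Real.exp (π * |Y|)) := by rw [e, mul_one]
    _ ≤ π * (Real.exp (-(π * |Y|)) * (2 * Real.cosh (π * Y))) := by gcongr
    _ = 2 * π * Real.exp (-(π * |Y|)) * Real.cosh (π * Y) := by ring

/-- **Pointwise bound on the line `Re u = mₙ + ½`** (`Y ≠ 0`, `n ≥ 1`), given the certificate with slope `2π − δ`. -/
theorem lineIntegrandT_le (hcert : ∀ η : ℝ, η ≠ 0 → rateT η - (2 * π - δ) * |η| ≤ M) {n : ℕ} (hn : 1 ≤ n)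
    {Y : ℝ} (hY : Y ≠ 0) :
    sech1 Y * ‖gT n (((((mLineT n : ℕ) : ℝ) + 1 / 2 : ℝ) : ℂ) + (Y : ℂ) * I)‖ ≤
      2 * π * Real.exp constLineT * (484 + Y ^ 2) ^ 9 * Real.exp (n * M) * Real.exp (-(δ / 2 * |Y|)) := by
  have hn0 : (0 : ℝ) < n := by exact_mod_cast (show 0 < n by omega)
  have hn1 : (1 : ℝ) ≤ n := by exact_mod_cast hn
  obtain ⟨η, hη⟩ : ∃ η : ℝ, η = Y / (2 * n) := ⟨_, rfl⟩
  have hη0 : η ≠ 0 := by rw [hη]; exact div_ne_zero hY (by positivity)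
  have hyη : 2 * ((n : ℝ) * η) = Y := by rw [hη]; field_simp
  -- the line point: `g(mₙ + ½ + iY) = R̂(wₙ + i·nη)`
  have hpt : gT n (((((mLineT n : ℕ) : ℝ) + 1 / 2 : ℝ) : ℂ) + (Y : ℂ) * I) =
      RCT (aT n) (bT n) ((wLineT n : ℂ) + (((n : ℝ) * η : ℝ) : ℂ) * I) := by
    rw [← hyη]; unfold gT wLineT mLineT; congr 1; push_cast; ring
  rw [hpt]
  have hL := log_norm_RCT_T_line_le hη0 hn
  have hc := hcert η hη0
  -- scale the certificate: n·rateT η ≤ n M + (2π − δ)·|Y|/2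
  have habs : (n : ℝ) * |η| = |Y| / 2 := by
    rw [← hyη, abs_mul, abs_mul, abs_of_pos hn0, abs_two]; ring
  have hc' : (n : ℝ) * rateT η ≤ n * M + (2 * π - δ) * (|Y| / 2) :=
    calc (n : ℝ) * rateT η = n * (rateT η - (2 * π - δ) * |η|) + (2 * π - δ) * (n * |η|) := by ring
      _ ≤ n * M + (2 * π - δ) * (n * |η|) := by gcongr
      _ = n * M + (2 * π - δ) * (|Y| / 2) := by rw [habs]
  -- (2η)² = (Y/n)² ≤ Y² and 19² ≤ 484
  have hlog : Real.log (19 ^ 2 + (2 * η) ^ 2) ≤ Real.log (484 + Y ^ 2) := by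
    apply Real.log_le_log (by positivity)
    have h2 : 2 * η = Y / n := by rw [hη]; field_simp
    have : (2 * η) ^ 2 ≤ Y ^ 2 := by rw [h2, div_pow]; exact div_le_self (sq_nonneg Y) (by nlinarith [hn1])
    nlinarith
  have hlog0 : 0 ≤ Real.log (484 + Y ^ 2) := Real.log_nonneg (by nlinarith [sq_nonneg Y])
  have h89 : 8 * Real.log (19 ^ 2 + (2 * η) ^ 2) ≤ 9 * Real.log (484 + Y ^ 2) := by nlinarith [hlog, hlog0]
  -- log of the numerator
  have hlogR : Real.log ‖RCT (aT n) (bT n) ((wLineT n : ℂ) + (((n : ℝ) * η : ℝ) : ℂ) * I)‖ ≤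
      n * M + (2 * π - δ) * (|Y| / 2) + 9 * Real.log (484 + Y ^ 2) + constLineT :=
    hL.trans (add_le_add (add_le_add hc' h89) le_rfl)
  have hR : ‖RCT (aT n) (bT n) ((wLineT n : ℂ) + (((n : ℝ) * η : ℝ) : ℂ) * I)‖ ≤
      Real.exp (n * M + (2 * π - δ) * (|Y| / 2) + 9 * Real.log (484 + Y ^ 2) + constLineT) := by
    rcases eq_or_lt_of_le (norm_nonneg (RCT (aT n) (bT n) ((wLineT n : ℂ) + (((n : ℝ) * η : ℝ) : ℂ) * I)))
      with h0 | hpos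
    · rw [← h0]; exact (Real.exp_pos _).le
    · exact (Real.log_le_iff_le_exp hpos).1 hlogR
  -- the exponentials
  have hexp : Real.exp (n * M + (2 * π - δ) * (|Y| / 2) + 9 * Real.log (484 + Y ^ 2) + constLineT) =
      Real.exp constLineT * (484 + Y ^ 2) ^ 9 * Real.exp (n * M) * Real.exp (-(δ / 2 * |Y|)) * Real.exp (π * |Y|) := by
    rw [show n * M + (2 * π - δ) * (|Y| / 2) + 9 * Real.log (484 + Y ^ 2) + constLineT =
      constLineT + 9 * Real.log (484 + Y ^ 2) + n * M + (-(δ / 2 * |Y|)) + π * |Y| by ring]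
    rw [Real.exp_add, Real.exp_add, Real.exp_add, Real.exp_add,
      show (9 : ℝ) * Real.log (484 + Y ^ 2) = Real.log ((484 + Y ^ 2) ^ 9) by rw [Real.log_pow]; push_cast; ring,
      Real.exp_log (by positivity)]
  have e : Real.exp (-(π * |Y|)) * Real.exp (π * |Y|) = 1 := by rw [← Real.exp_add, neg_add_cancel, Real.exp_zero]
  calc sech1 Y * ‖RCT (aT n) (bT n) ((wLineT n : ℂ) + (((n : ℝ) * η : ℝ) : ℂ) * I)‖
      ≤ (2 * π * Real.exp (-(π * |Y|))) *
          Real.exp (n * M + (2 * π - δ) * (|Y| / 2) + 9 * Real.log (484 + Y ^ 2) + constLineT) :=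
        mul_le_mul (sech1_le_exp Y) hR (norm_nonneg _) (by positivity)
    _ = 2 * π * Real.exp constLineT * (484 + Y ^ 2) ^ 9 * Real.exp (n * M) * Real.exp (-(δ / 2 * |Y|)) *
          (Real.exp (-(π * |Y|)) * Real.exp (π * |Y|)) := by rw [hexp]; ring
    _ = 2 * π * Real.exp constLineT * (484 + Y ^ 2) ^ 9 * Real.exp (n * M) * Real.exp (-(δ / 2 * |Y|)) := by
        rw [e, mul_one]

/-- The integral of the majorant: `∫ sech1·‖g‖ ≤ 2π e^{constLineT} e^{nM} · ∫ (484+Y²)⁹ e^{−(δ/2)|Y|}` (`n ≥ 1`). -/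
theorem integral_lineIntegrandT_le (hδ : 0 < δ) (hcert : ∀ η : ℝ, η ≠ 0 → rateT η - (2 * π - δ) * |η| ≤ M)
    {n : ℕ} (hn : 1 ≤ n) :
    ∫ Y : ℝ, sech1 Y * ‖gT n (((((mLineT n : ℕ) : ℝ) + 1 / 2 : ℝ) : ℂ) + (Y : ℂ) * I)‖ ≤
      2 * π * Real.exp constLineT * Real.exp (n * M) * ∫ Y : ℝ, (484 + Y ^ 2) ^ 9 * Real.exp (-(δ / 2 * |Y|)) := by
  rw [← integral_const_mul]
  refine integral_mono_of_nonneg (Filter.Eventually.of_forall fun Y => mul_nonneg (sech1_nonneg Y) (norm_nonneg _))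
    ((integrable_poly_exp (δ := δ / 2) (by positivity)).const_mul _) ?_
  have h0 : ∀ᵐ Y : ℝ ∂volume, Y ≠ 0 := by
    have : (volume : Measure ℝ) {0} = 0 := measure_singleton 0
    filter_upwards [measure_eq_zero_iff_ae_notMem.1 this] with Y hY
    simpa using hY
  filter_upwards [h0] with Y hY
  have := lineIntegrandT_le hcert hn hY
  calc sech1 Y * ‖gT n (((((mLineT n : ℕ) : ℝ) + 1 / 2 : ℝ) : ℂ) + (Y : ℂ) * I)‖
      ≤ 2 * π * Real.exp constLineT * (484 + Y ^ 2) ^ 9 * Real.exp (n * M) * Real.exp (-(δ / 2 * |Y|)) := this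
    _ = 2 * π * Real.exp constLineT * Real.exp (n * M) * ((484 + Y ^ 2) ^ 9 * Real.exp (-(δ / 2 * |Y|))) := by ring

/-- **`DecayT c` from the certificate**: if for some `δ > 0` and `M` the explicit rate function satisfies
`rateT η − (2π − δ)|η| ≤ M` for all `η ≠ 0`, then `DecayT c` holds for every `c < −M`
(line representation, strip shift, line bound and `dy`-assembly all PROVED in U2-1 … U2-6; only the one-variable
inequality is an input — numerically any `M ≥ −29.107 + 1.3·δ` is attainable, e.g. `(δ, M) = (1/50, −29.02)`). -/
theorem decayT_of_certificate (hδ : 0 < δ) (hcert : ∀ η : ℝ, η ≠ 0 → rateT η - (2 * π - δ) * |η| ≤ M) {c : ℝ}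
    (hc : c < -M) : DecayT c := by
  unfold DecayT
  set ε : ℝ := -M - c with hεdef
  have hε : 0 < ε := by rw [hεdef]; linarith
  set A : ℝ := 1 / (4 * Real.pi) *
    (2 * π * Real.exp constLineT * ∫ Y : ℝ, (484 + Y ^ 2) ^ 9 * Real.exp (-(δ / 2 * |Y|))) with hA
  -- eventually: A ≤ e^{εn}
  have hev : ∀ᶠ n : ℕ in atTop, A ≤ Real.exp (ε * n) := by
    have ht : Tendsto (fun n : ℕ => Real.exp (ε * n)) atTop atTop :=
      Real.tendsto_exp_atTop.comp (tendsto_natCast_atTop_atTop.const_mul_atTop hε)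
    exact ht.eventually_ge_atTop _
  filter_upwards [hev, Filter.eventually_ge_atTop 1] with n hK hn1
  have hI := integral_lineIntegrandT_le hδ hcert hn1
  calc |(formQT (aT n) (bT n) : ℝ) * zetaValue 2 - (formPT (aT n) (bT n) : ℝ)|
      ≤ 1 / (4 * Real.pi) * ∫ Y : ℝ, sech1 Y * ‖gT n (((((mLineT n : ℕ) : ℝ) + 1 / 2 : ℝ) : ℂ) + (Y : ℂ) * I)‖ :=
        abs_formT_le_of_line hn1 (mLineT_le n)
    _ ≤ 1 / (4 * Real.pi) * (2 * π * Real.exp constLineT * Real.exp (n * M) *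
          ∫ Y : ℝ, (484 + Y ^ 2) ^ 9 * Real.exp (-(δ / 2 * |Y|))) := mul_le_mul_of_nonneg_left hI (by positivity)
    _ = A * Real.exp (n * M) := by rw [hA]; ring
    _ ≤ Real.exp (ε * n) * Real.exp (n * M) := by gcongr
    _ = Real.exp (-(c * n)) := by rw [← Real.exp_add]; congr 1; rw [hεdef]; ring

/-- **The two normal forms agree** (`η ≠ 0`): fam-measure's `rateT` (P1's `prim`, doubled block at height `2η`) is
P1 g10's `profileT0 (−897/100)` (fam-denom's `gPrim` form): `prim = gPrim`, `gPrim (2η) (2V) = 2(gPrim η V + V log 2)`,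
and `2·(703/100)·log 2 + 2·(147/100)·log 2 = 17 log 2`. -/
theorem rateT_eq {η : ℝ} (hη : η ≠ 0) : rateT η = profileT0 (-897 / 100) η := by
  have h1 : prim (2 * η) (703 / 50) = 2 * (gPrim η (703 / 100) + 703 / 100 * Real.log 2) := by
    rw [prim_eq_gPrim, show (703 / 50 : ℝ) = 2 * (703 / 100) by norm_num]; exact gPrim_scale hη two_pos _
  have h2 : prim (2 * η) (-147 / 50) = 2 * (gPrim η (-147 / 100) + -147 / 100 * Real.log 2) := by
    rw [prim_eq_gPrim, show (-147 / 50 : ℝ) = 2 * (-147 / 100) by norm_num]; exact gPrim_scale hη two_pos _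
  simp only [rateT, kappaT, profileT0, profileTConst, prim_eq_gPrim] at h1 h2 ⊢
  rw [h1, h2, show (-897 / 100 : ℝ) + 16 = 703 / 100 by norm_num,
    show (-897 / 100 : ℝ) + 15 / 2 = -147 / 100 by norm_num,
    show (-897 / 100 : ℝ) + 11 = 203 / 100 by norm_num, show (-897 / 100 : ℝ) + 6 = -297 / 100 by norm_num,
    show (-897 / 100 : ℝ) + 24 = 1503 / 100 by norm_num, show (-897 / 100 : ℝ) + 13 = 403 / 100 by norm_num,
    show (-897 / 100 : ℝ) + 26 = 1703 / 100 by norm_num, show (-897 / 100 : ℝ) + 15 = 603 / 100 by norm_num]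
  ring

/-- **`DecayT c` for every `c < 29.10786` from a certificate of P1 g10's shape**: the hypothesis is literally the
statement of `TwoTaleP15SecondLineCertificate.certT_delta` (`0 ≤ δ ≤ 3`, slack `7δ`, abscissa `−897/100`);
take `δ = min 3 ((29.10786 − c)/14)` in `decayT_of_certificate` and rewrite with `rateT_eq`. -/
theorem decayT_of_certT
    (hcert : ∀ δ : ℝ, 0 ≤ δ → δ ≤ 3 → ∀ η : ℝ, η ≠ 0 →
      profileT0 (-897 / 100) η - (2 * π - δ) * |η| ≤ -29.10786 + 7 * δ)
    {c : ℝ} (hc : c < 29.10786) : DecayT c := by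
  have hδ0 : 0 < min 3 ((29.10786 - c) / 14) := lt_min (by norm_num) (by linarith)
  have hδc : min 3 ((29.10786 - c) / 14) ≤ (29.10786 - c) / 14 := min_le_right _ _
  refine decayT_of_certificate hδ0 (M := -29.10786 + 7 * min 3 ((29.10786 - c) / 14)) (fun η hη => ?_) (by linarith)
  rw [rateT_eq hη]
  exact hcert _ hδ0.le (min_le_left _ _) η hη

end Summit.KontsevichZagierPeriods.Zeta5Search.TwoTaleSecondTaleLineDecay

end
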